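import Summits.HodgeConjecture.HodgeConjecture.Theorems.MilnorKExponentialSymbolLiftRAlternation
import HarnessLib

/-!
# Antisymmetry and torsion in the naive Milnor relations (weight-2 Appell–Humbert line)

Theorems file of route `MilnorKExponential` of the Hodge summit, crux `SymbolLiftR`
(stmt-HodgeConjecture-18702), kernel `stub_primitiveLiftExists`, abelian sector. Companion of
`MilnorKExponentialSymbolLiftRAlternation` (alternation `2·[x, −x] ∈ milnorRel E W 2`): the two other
soundness ingredients of the weight-2 Appell–Humbert calculus (`Cruxes/SymbolLiftR/AH2-REPORT.md`), which
models Milnor symbols of exponential-affine units by the exterior square `∧²` of the unit group `⊗ ℚ`: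

* `two_smul_mk_symbol_add_swap` / `stub_two_smul_single_add_single_swap_mem_milnorRel` —
  **antisymmetry up to `2`-torsion**, `2·([u, v] + [v, u]) ∈ milnorRel E W 2`, from the expansion
  `{uv, −uv} = {u, −u} + {u, v} + {v, −v} + {v, u}` and three alternation instances;
* `nsmul_single_mem_milnorRel_of_pow_eq_one` / `stub_nsmul_single_mem_milnorRel_of_pow_eq_one` —
  **torsion units give torsion symbols**, `N·[t] ∈ milnorRel E W p` when an entry of `t` is pointwise
  an `N`-th root of unity (adapted from the strategist's workfile `Cruxes/SymbolLiftR/TorsionSymbolsDie.lean`):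
  the reason Appell–Humbert cochains with RATIONAL periods close.

References: J. Milnor, *Introduction to Algebraic K-Theory*, Ann. of Math. Studies 72 (1971), §11;
M. Kerz, *The Gersten conjecture for Milnor K-theory*, Invent. Math. 175 (2009), §2.
-/

noncomputable section

-- The mandated namespace repeats `HodgeConjecture` (single-conjunct summit).
set_option linter.dupNamespace false

open scoped Manifold
open Function

namespace Summit.HodgeConjecture.HodgeConjecture.Theorems.SymbolLiftR

open Literature.Geometry.Kaehler

variable {E : Type*} [NormedAddCommGroup E] [NormedSpace ℂ E]
  {M : Type*} [TopologicalSpace M] [ChartedSpace E M] {W : Set M}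

/-! ### Antisymmetry: `2·({u, v} + {v, u}) ≡ 0` -/

section Antisymmetry

variable {A : Type*} [AddCommGroup A] (φ : ((Fin 2 → M → ℂ) →₀ ℤ) →+ A)
  (hφ : ∀ s ∈ milnorRel E W 2, φ s = 0)

include hφ

/-- **Antisymmetry up to `2`-torsion**: `2·({u, v} + {v, u}) = 0` through any additive `φ` killing
`milnorRel E W 2`, for units `u`, `v` on `W` admitting the auxiliary constants of
`two_smul_mk_symbol_neg_self` for `u`, `v` and `u·v`. Expansion of `{uv, −uv}` by bilinearity:
`{uv, −uv} = {u, −u} + {u, v} + {v, −v} + {v, u}`, and the three alternation instances.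
Together with alternation this makes the naive `K₂`-presheaf `⊗ ℤ[1/2]` on small opens a quotient of
the exterior square `∧²` of the unit group — the model of the weight-2 Appell–Humbert calculus.
[cite: Milnor1972, §11 Thm. 11.1] [cite: Kerz2009GerstenMilnorK, §2] -/
theorem two_smul_mk_symbol_add_swap {u v : M → ℂ} (hu : IsHolUnitOn E W u) (hv : IsHolUnitOn E W v)
    {c₁ c₂ c₃ : ℂ} (h10 : c₁ ≠ 0) (h11 : c₁ ≠ 1) (hu1 : ∀ z ∈ W, u z ≠ c₁)
    (hu1' : ∀ z ∈ W, u z * c₁ ≠ 1) (h20 : c₂ ≠ 0) (h21 : c₂ ≠ 1) (hv2 : ∀ z ∈ W, v z ≠ c₂)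
    (hv2' : ∀ z ∈ W, v z * c₂ ≠ 1) (h30 : c₃ ≠ 0) (h31 : c₃ ≠ 1)
    (huv3 : ∀ z ∈ W, u z * v z ≠ c₃) (huv3' : ∀ z ∈ W, u z * v z * c₃ ≠ 1) :
    (2 : ℤ) • (φ (Finsupp.single ![u, v] (1 : ℤ)) + φ (Finsupp.single ![v, u] 1)) = 0 := by
  have huv : IsHolUnitOn E W (u * v) := hu.mul hv
  have a1 := two_smul_mk_symbol_neg_self φ hφ hu h10 h11 hu1 hu1'
  have a2 := two_smul_mk_symbol_neg_self φ hφ hv h20 h21 hv2 hv2'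
  have a3 := two_smul_mk_symbol_neg_self φ hφ huv h30 h31 (fun z hz ↦ by simpa using huv3 z hz)
    (fun z hz ↦ by simpa using huv3' z hz)
  -- `{uv, −uv} = {u, −u} + {u, v} + ({v, −v} + {v, u})`
  have e : φ (Finsupp.single ![u * v, -(u * v)] 1) =
      φ (Finsupp.single ![u, -u] 1) + φ (Finsupp.single ![u, v] 1) +
        (φ (Finsupp.single ![v, -v] 1) + φ (Finsupp.single ![v, u] 1)) := by
    rw [mk_symbol_mul_left φ hφ hu hv (isHolUnitOn_neg huv)]
    have s1 : φ (Finsupp.single ![u, -(u * v)] 1) = φ (Finsupp.single ![u, (-u) * v] 1) :=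
      mk_symbol_congr φ hφ hu (isHolUnitOn_neg huv) hu ((isHolUnitOn_neg hu).mul hv) (fun _ _ ↦ rfl)
        (fun z _ ↦ by simp)
    have s2 : φ (Finsupp.single ![v, -(u * v)] 1) = φ (Finsupp.single ![v, (-v) * u] 1) :=
      mk_symbol_congr φ hφ hv (isHolUnitOn_neg huv) hv ((isHolUnitOn_neg hv).mul hu) (fun _ _ ↦ rfl)
        (fun z _ ↦ by simp [mul_comm])
    rw [s1, s2, mk_symbol_mul_right φ hφ hu (isHolUnitOn_neg hu) hv,
      mk_symbol_mul_right φ hφ hv (isHolUnitOn_neg hv) hu]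
  rw [e, smul_add, smul_add, smul_add, a1, a2, zero_add, zero_add] at a3
  rw [smul_add]
  exact a3

end Antisymmetry

/-- STUB-HELPER `stub_two_smul_single_add_single_swap_mem_milnorRel` (weight-2 Appell–Humbert line,
abelian sector of the kernel of crux stmt-HodgeConjecture-18702): **antisymmetry in the naive Milnor
relations up to `2`-torsion** — `2·([u, v] + [v, u]) ∈ milnorRel E W 2` for units `u`, `v` on `W`
admitting auxiliary constants `c₁, c₂, c₃ ∉ {0, 1}` avoided by `u`, `v`, `uv` and by their
reciprocals (available after shrinking `W` around any point).
[cite: Milnor1972, §11 Thm. 11.1] [cite: Kerz2009GerstenMilnorK, §2] -/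
theorem stub_two_smul_single_add_single_swap_mem_milnorRel : ∀ {E : Type*} [NormedAddCommGroup E] [NormedSpace ℂ E] {M : Type*} [TopologicalSpace M] [ChartedSpace E M] {W : Set M} {u v : M → ℂ}, IsHolUnitOn E W u → IsHolUnitOn E W v → ∀ {c₁ c₂ c₃ : ℂ}, c₁ ≠ 0 → c₁ ≠ 1 → (∀ z ∈ W, u z ≠ c₁) → (∀ z ∈ W, u z * c₁ ≠ 1) → c₂ ≠ 0 → c₂ ≠ 1 → (∀ z ∈ W, v z ≠ c₂) → (∀ z ∈ W, v z * c₂ ≠ 1) → c₃ ≠ 0 → c₃ ≠ 1 → (∀ z ∈ W, u z * v z ≠ c₃) → (∀ z ∈ W, u z * v z * c₃ ≠ 1) → (2 : ℤ) • (Finsupp.single ![u, v] (1 : ℤ) + Finsupp.single ![v, u] 1) ∈ milnorRel E W 2 := by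
  intro E _ _ M _ _ W u v hu hv c₁ c₂ c₃ h10 h11 hu1 hu1' h20 h21 hv2 hv2' h30 h31 huv3 huv3'
  have h := two_smul_mk_symbol_add_swap (QuotientAddGroup.mk' (milnorRel E W 2))
    (fun s hs ↦ (QuotientAddGroup.eq_zero_iff s).2 hs) hu hv h10 h11 hu1 hu1' h20 h21 hv2 hv2'
    h30 h31 huv3 huv3'
  rw [← map_add, ← map_zsmul] at h
  exact (QuotientAddGroup.eq_zero_iff _).1 h

/-! ### Torsion units give torsion symbols (adapted from `Cruxes/SymbolLiftR/TorsionSymbolsDie.lean`,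
the strategist's first lemma of idea `appell-humbert-weight-p`, kernel-checked there) -/

section Torsion

variable {p : ℕ}

/-- Powers of a unit on `W` are units on `W`. [folklore] -/
theorem isHolUnitOn_pow {f : M → ℂ} (hf : IsHolUnitOn E W f) : ∀ k : ℕ, IsHolUnitOn E W (f ^ k)
  | 0 => by simpa using isHolUnitOn_one (E := E) W
  | k + 1 => by
    rw [pow_succ]
    exact (isHolUnitOn_pow hf k).mul hf

/-- `[…, 1, …] ∈ milnorRel`: a tuple with an entry equal to the constant `1` is a relation
(multilinearity with `fᵢ = g = 1`: `[t] - [t] - [t] = -[t]`). [folklore] -/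
theorem single_update_one_mem_milnorRel {t : Fin p → M → ℂ} (ht : IsGoodTuple E W t) (i : Fin p) :
    Finsupp.single (update t i (1 : M → ℂ)) 1 ∈ milnorRel E W p := by
  -- adapted from reserve-free workfile Cruxes/SymbolLiftR/TorsionSymbolsDie.lean (strategist, 2026-08-17)
  set t₁ : Fin p → M → ℂ := update t i 1 with ht₁def
  have ht₁ : IsGoodTuple E W t₁ := ht.update i (isHolUnitOn_one W)
  have h := multilinear_mem_milnorRel (E := E) ht₁ i (isHolUnitOn_one (E := E) W)
  have e1 : update t₁ i (t₁ i * 1) = t₁ := by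
    rw [mul_one, update_eq_self]
  have e2 : update t₁ i (1 : M → ℂ) = t₁ := by
    rw [ht₁def, update_idem, ← ht₁def]
  rw [e1, e2, sub_self, zero_sub] at h
  exact neg_mem_iff.1 h

/-- `[…, fᵢ^k, …] - k · […, fᵢ, …] ∈ milnorRel` for `k ≥ 1` (multilinearity, induction on `k`).
[folklore] -/
theorem single_update_pow_sub_smul_mem_milnorRel {t : Fin p → M → ℂ} (ht : IsGoodTuple E W t)
    (i : Fin p) : ∀ k : ℕ, 1 ≤ k →
      Finsupp.single (update t i (t i ^ k)) 1 - (k : ℤ) • Finsupp.single t 1 ∈ milnorRel E W p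
  | 0, hk => absurd hk (by omega)
  | 1, _ => by
    have : update t i (t i ^ 1) = t := by rw [pow_one, update_eq_self]
    rw [this, Nat.cast_one, one_smul, sub_self]
    exact zero_mem _
  | k + 2, _ => by
    set t' : Fin p → M → ℂ := update t i (t i ^ (k + 1)) with ht'def
    have ht' : IsGoodTuple E W t' := ht.update i (isHolUnitOn_pow (ht i) (k + 1))
    have hmul := multilinear_mem_milnorRel (E := E) ht' i (ht i)
    have e1 : update t' i (t' i * t i) = update t i (t i ^ (k + 2)) := by
      rw [ht'def, update_idem, update_self, ← pow_succ]
    have e2 : update t' i (t i) = t := by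
      rw [ht'def, update_idem, update_eq_self]
    rw [e1, e2] at hmul
    have ih := single_update_pow_sub_smul_mem_milnorRel ht i (k + 1) (by omega)
    have hsum := add_mem hmul ih
    have e3 : Finsupp.single (update t i (t i ^ (k + 2))) 1 - Finsupp.single t' 1 -
          Finsupp.single t 1 +
        (Finsupp.single (update t i (t i ^ (k + 1))) 1 - ((k + 1 : ℕ) : ℤ) • Finsupp.single t 1) =
        Finsupp.single (update t i (t i ^ (k + 2))) (1 : ℤ) -
          ((k + 2 : ℕ) : ℤ) • Finsupp.single t 1 := by
      rw [ht'def]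
      push_cast
      module
    rw [e3] at hsum
    exact hsum

/-- **Torsion units give torsion symbols.** If the `i`-th entry of a good `p`-tuple `t` on `W` is
pointwise an `N`-th root of unity on `W`, `N ≥ 1`, then `N · [t]` lies in the naive Milnor
relations over `W` (`{…, ζ, …}` is `N`-torsion; over `ℚ` it dies) — the arithmetic reason why
Appell–Humbert symbol cochains with RATIONAL periods close. [folklore] -/
theorem nsmul_single_mem_milnorRel_of_pow_eq_one {t : Fin p → M → ℂ} (ht : IsGoodTuple E W t)
    (i : Fin p) {N : ℕ} (hN : 0 < N) (h : ∀ x ∈ W, t i x ^ N = 1) :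
    (N : ℤ) • Finsupp.single t (1 : ℤ) ∈ milnorRel E W p := by
  have h1 := single_update_pow_sub_smul_mem_milnorRel (E := E) ht i N hN
  have h2 : Finsupp.single (update t i (t i ^ N)) 1 - Finsupp.single (update t i (1 : M → ℂ)) 1 ∈
      milnorRel E W p := by
    refine single_sub_single_mem_milnorRel (ht.update i (isHolUnitOn_pow (ht i) N))
      (ht.update i (isHolUnitOn_one W)) fun j x hx ↦ ?_
    rcases eq_or_ne j i with rfl | hj
    · simp only [update_self, Pi.pow_apply, Pi.one_apply]
      exact h x hx
    · simp only [update_of_ne hj]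
  have h3 := single_update_one_mem_milnorRel (E := E) ht i
  have key : (N : ℤ) • Finsupp.single t (1 : ℤ) =
      -(Finsupp.single (update t i (t i ^ N)) 1 - (N : ℤ) • Finsupp.single t 1) +
        (Finsupp.single (update t i (t i ^ N)) 1 - Finsupp.single (update t i (1 : M → ℂ)) 1) +
        Finsupp.single (update t i (1 : M → ℂ)) 1 := by
    abel
  rw [key]
  exact add_mem (add_mem (neg_mem h1) h2) h3

end Torsion

/-- STUB-HELPER `stub_nsmul_single_mem_milnorRel_of_pow_eq_one` (weight-2 Appell–Humbert line, abelian
sector of the kernel of crux stmt-HodgeConjecture-18702): **torsion units give torsion symbols** — if one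
entry of a good `p`-tuple is pointwise an `N`-th root of unity on `W` (`N ≥ 1`) then `N·[t] ∈ milnorRel E W p`
(`nsmul_single_mem_milnorRel_of_pow_eq_one`, adapted from the strategist's workfile). [folklore] -/
theorem stub_nsmul_single_mem_milnorRel_of_pow_eq_one : ∀ {E : Type*} [NormedAddCommGroup E] [NormedSpace ℂ E] {M : Type*} [TopologicalSpace M] [ChartedSpace E M] {W : Set M} {p : ℕ} {t : Fin p → M → ℂ}, IsGoodTuple E W t → ∀ (i : Fin p) {N : ℕ}, 0 < N → (∀ x ∈ W, t i x ^ N = 1) → (N : ℤ) • Finsupp.single t (1 : ℤ) ∈ milnorRel E W p := by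
  intro E _ _ M _ _ W p t ht i N hN h
  exact nsmul_single_mem_milnorRel_of_pow_eq_one ht i hN h

end Summit.HodgeConjecture.HodgeConjecture.Theorems.SymbolLiftR

end
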